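import Literature.NumberTheory.EllipticCurves.PAdicTwoVariableColemanImageNonvanishingOfMoment
import Literature.NumberTheory.GaloisRepresentations.LubinTateColemanCoordCoinvariantTwistTwo
import HarnessLib

/-!
# Brick (c) at `p = 2`, the SEAM at one `𝔓` and one unramified level — the WEIGHT-`k`, LEVEL-`m` READING OF THE DIVIDED SERIES `L`:
# if `φ_ε(Σ_j Col β (j)) = (t_v·C g − n)·L` in `Λ = 𝒪_F⟦X⟧⟦T⟧` then, at every unramified level `E_m` and every weight `k ≡ parity(ε)`,
# `(Tr θ_m)·(v^{k+1} − n)·L(0; γ^{k+1} − 1)·mom_k(1) = Σ_{σ ∈ Gal(E_m/F)} σ(mom_k(r_{β,m}))` — de Shalit II §4.12 (31) on the series side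

Cell `bsd-print-cf2`, width seat `bsd-line-cf2c-w7` g31, route C `PrintCf2RubinValueTwo`, crux of record stmt-BirchSwinnertonDyer-24033
`TwoVariableMainConjAtSplitTwoQuad` (23720 nominal), BRICK §4(c), memo v12 (M2)(i) (D6-core at one `𝔓`, one level); `--supports` the crux as a
helper.  THEOREMS ONLY (0 sorry, no named fact, no definition); Theses-free; β-agnostic (any base-norm-coherent family).  BSD is not proved by any of this.

De Shalit II §4.12 (31): the two-variable measure `μ(𝔣)` is pinned by `(N𝔞 − ψ(𝔞)^k)·∫ κ^k dμ = δ_k(e(𝔞))`, the Coates–Wiles values of the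
elliptic units.  On the series side of the tree the (c)-capstones carry the divided series `L = L_ε ∈ Λ` with
`φ_ε(Σ_j Col⟨e(𝔟)⟩(j)) = (t_{χ(σ̃_𝔟)}·C g_𝔟 − N𝔟)·L` (`…ColemanCoinvariantCharTraceEllipticUnitsResidualDischarged`, T9′), and the measure lane
(`…EllipticUnitsLocalMeasure`, `PAdicOneVariableSeriesFamilyOfColemanCoordModule`) reads the moments `mom_k(r_{β,m})` of the level-`m` Coleman
coordinates as `∫ κ^{k+1}` of its one-`𝔓` measures (`[S⁰] D^k (j(Φ r) ∘ ϑ) = ε_ϑ^k · j(mom_k(r))`).  THIS file proves the print-free junction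
of the two currencies at the TRIVIAL character of the unramified direction (`X ↦ 0`), for EVERY level `m` and every weight `k` of the parity
of `ε`:

* ★★★ `sum_coordMoment_relUnitCoordTwo_eq_of_colemanDeltaCoinvFun_indexTraceₗ_eq` — for a base-norm-coherent family `β = (β_m)`, a unit `v`,
  an `X`-series `g` with `g(0) = 1`, `n ∈ ℕ` and `L ∈ Λ` with `φ_ε(Σ_j Col β (j)) = (t_v·C g − C n)·L`:
  **`Σ_{σ ∈ Gal(E_m/F)} σ(mom_k(r_{β,m})) = (Σ_σ σθ_m) · ((v^{k+1} − n) · L(0; a_k) · mom_k(1))`**, `a_k = γ^{k+1} − 1`,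
  `L(0; a_k) = tEval_{a_k}(κ_m L)`, `κ_m = ι_m ∘ (X ↦ 0)` — base change of `φ_ε` (`colemanDeltaCoinvFun_map`, `…_unitTwistₗ_one_map`), the
  one-level weight reading `tEval_mul_coordMoment_one_eq_of_eq_mul`, and the specialised trace `sum_unitBallEquiv_mul_coordMoment_specialization`.
HONEST LABEL (pen rail (i), 2026-08-31): this is the **trivial-character component of the level-m identity; NOT the level-m identity**.  THE GAP,
named: the non-trivial characters `χ ≠ 1` of `Gal(E_m/F)` — reading `Λ = 𝒪_F⟦X⟧⟦T⟧` at `X ↦ ζ − 1` (`ζ` of order `p^m`) needs a base-change ring map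
`Λ → 𝒪_F[ζ_{p^m}]⟦T⟧` carrying `colemanDeltaCoinvFun_map`-type and `unitTwistₗ` compatibilities (or the group-ring form of `isTransformProd_colemanImage`);
the tree has the `X ↦ 0` instance only ((M2)(i)′, memo v13).  Also NOT here: the gluing over levels/weights and the period normalisation ((M2)(ii)(iii)).

## References
* [deShalit1987] E. de Shalit, *Iwasawa theory of elliptic curves with complex multiplication* (1987), I §3.1, §3.5 (11), §3.8 (16)–(17);
  II §4.7 (15)–(17), §4.12 (29)–(33); III §1.3, §1.8 (14)–(15), §1.10 (17).
-/

noncomputable section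

set_option linter.dupNamespace false
set_option autoImplicit false

open scoped PowerSeries.WithPiTopology

namespace Summit.BirchSwinnertonDyer.BirchSwinnertonDyer.Theorems.PrintCf2.SeamColemanDictionaryLevel

open ValuativeRel IsLocalRing Field Finset
open Literature.NumberTheory.GaloisRepresentations Literature.NumberTheory.GaloisRepresentations.IsNonarchimedeanLocalField
  Literature.NumberTheory.GaloisRepresentations.LubinTate
open Literature.NumberTheory.EllipticCurves

variable {F : Type} [Field F] [ValuativeRel F] [TopologicalSpace F] [IsNonarchimedeanLocalField F]

attribute [local instance] ltNormUniformSpace ltNormIsUniformAddGroup rk1 nF nE fintypeResidueField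

variable {p : ℕ} [hp : Fact p.Prime] {d : ℕ} [NeZero d] (hd : d.Coprime p)
variable {π : 𝒪[F]} (hπ : (valuation F).IsUniformizer (π : F))
variable (E : ℕ → IntermediateField F (AlgebraicClosure F)) [∀ m, FiniteDimensional F (E m)] [∀ m, Normal F (E m)]
  [∀ m, IsGalois F (E m)] (hmono : Monotone E) (hE : ∀ m, E m ≤ maxUnramified F) (hdeg : ∀ m, Module.finrank F (E m) = d * p ^ m)
  {σ₀ : absoluteGaloisGroup F} (hσ₀ : IsAbsArithFrob σ₀) (hq : residueFieldCard F = 2)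
variable (u : (LTCoeff F)ˣ) (hu : LTCoeff.of F π = residueFieldCard F * u) (γ : 𝒪[F]ˣ)
variable [IsAdicComplete (Ideal.span {intBase F (LTCoeff.of F π)}) (PowerSeries 𝒪[F])]
variable (w : 𝒪[F]ˣ) (hγ : (γ : 𝒪[F]) = 1 + π ^ 2 * w) (ε : PowerSeries (PowerSeries 𝒪[F]))
variable [IsAdicComplete (Ideal.span {(p : 𝒪[F])}) 𝒪[F]]
variable {θ : ∀ m, unitBall (E m)} (hθ : ∀ m, IsIntegralNormalGen (E m) (θ m))
  (hcoh : ∀ m, unitBallTrace (hmono (Nat.le_succ m)) (θ (m + 1)) = θ m)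

set_option maxHeartbeats 800000 in
include hdeg hE hσ₀ in
/-- ★★★ **THE WEIGHT-`k`, LEVEL-`m` READING OF THE DIVIDED SERIES AT THE TRIVIAL UNRAMIFIED CHARACTER** (de Shalit II §4.12 (31) on the
series side, one prime, `q = 2`).  Let `β = (β_m)_m` be base-norm-coherent with two-variable Coleman transform `Col β`, and suppose
`φ_ε(Σ_j Col β (j)) = (t_v·C g − C n)·L` in `Λ = 𝒪_F⟦X⟧⟦T⟧` for a unit `v ∈ 𝒪_F^×`, an `X`-series `g` with `g(0) = 1` (an Amice element), `n ∈ ℕ`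
and `L ∈ Λ`.  Then for every level `m` and every weight `k` with `κ_m ε = (−1)^{k+1}` (`κ_m = ι_m ∘ (X ↦ 0)`):
**`Σ_{σ ∈ Gal(E_m/F)} σ(mom_k(r_{β,m})) = (Σ_σ σθ_m) · ((v^{k+1} − n) · tEval_{a_k}(κ_m L) · mom_k(1))`**, `a_k = γ^{k+1} − 1` — the Galois trace of
the `k`-th Coates–Wiles moment of the level-`m` coordinate is the value of `L` at `(X, T) = (0, γ^{k+1} − 1)` times the explicit factor
`(Tr θ_m)(v^{k+1} − n)·mom_k(1)`.  (Trivial-character component of the level-`m` identity; NOT the level-`m` identity.)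
[cite: deShalit1987, I §3.5 (11), §3.8 (16)–(17); II §4.12 (29)–(31); III §1.8 (14)–(15)] -/
theorem sum_coordMoment_relUnitCoordTwo_eq_of_colemanDeltaCoinvFun_indexTraceₗ_eq
    {β : ∀ m, RelNormCoherentUnits hπ (E m)} (hβ : ∀ m, (β (m + 1)).baseNorm hπ (hmono (Nat.le_succ m)) = β m)
    (v : 𝒪[F]ˣ) (g : PowerSeries 𝒪[F]) (hg : PowerSeries.constantCoeff g = 1) (n : ℕ) (L : PowerSeries (PowerSeries 𝒪[F]))
    (hL : colemanDeltaCoinvFun hπ hq (intBase F) u hu γ (eq_zero_of_C_pi_mul_eq_zero_integer hπ) w hγ ε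
        (indexTraceₗ hπ hq u hu γ (colemanImage hd hπ E hmono hE hdeg hσ₀ hq u hu γ hθ hcoh hβ)) =
      (colemanDeltaCoinvFun hπ hq (intBase F) u hu γ (eq_zero_of_C_pi_mul_eq_zero_integer hπ) w hγ ε
          (unitTwistₗ hπ hq (intBase F) u hu γ v (TActModule.ofPS _ _ 1)) * PowerSeries.C g - PowerSeries.C ((n : ℕ) : PowerSeries 𝒪[F])) * L)
    (m k : ℕ) [IsAdicComplete (Ideal.span {algebraMap (LTCoeff F) (unitBall (E m)) (LTCoeff.of F π)}) (unitBall (E m))]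
    (hεk : PowerSeries.map ((algebraMap 𝒪[F] (unitBall (E m))).comp (PowerSeries.constantCoeff (R := 𝒪[F]))) ε = (-1) ^ (k + 1)) :
    ∑ σ : E m ≃ₐ[F] E m, unitBallEquiv (E m) σ (coordMoment hπ (E m) u k (relUnitCoordTwo hπ (E m) hq (hE m) hσ₀ u hu (β m))) =
      (∑ σ : E m ≃ₐ[F] E m, unitBallEquiv (E m) σ (θ m)) *
        ((algebraMap 𝒪[F] (unitBall (E m)) (v : 𝒪[F]) ^ (k + 1) - (n : unitBall (E m))) *
          tEval (algebraMap_unit_pow_sub_one_mem hπ (E m) hq γ k)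
            (PowerSeries.map ((algebraMap 𝒪[F] (unitBall (E m))).comp (PowerSeries.constantCoeff (R := 𝒪[F]))) L) *
          coordMoment hπ (E m) u k 1) := by
  set κ : PowerSeries 𝒪[F] →+* unitBall (E m) := (algebraMap 𝒪[F] (unitBall (E m))).comp (PowerSeries.constantCoeff (R := 𝒪[F])) with hκ
  set x := indexTraceₗ hπ hq u hu γ (colemanImage hd hπ E hmono hE hdeg hσ₀ hq u hu γ hθ hcoh hβ) with hx
  have hreg' : ∀ y : unitBall (E m), algebraMap (LTCoeff F) (unitBall (E m)) (LTCoeff.of F π) * y = 0 → y = 0 :=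
    fun y hy ↦ eq_zero_of_algebraMap_ltCoeff_pi_mul_eq_zero hπ (E m) y hy
  -- base change of `φ_ε` and of the twist scalar along `κ_m`
  have hbc := colemanDeltaCoinvFun_map hπ hq (intBase F) (algebraMap (LTCoeff F) (unitBall (E m))) κ (constantCoeff_comp_intBase (E m))
    u hu γ (eq_zero_of_C_pi_mul_eq_zero_integer hπ) hreg' w hγ ε x
  have htw := colemanDeltaCoinvFun_unitTwistₗ_one_map hπ hq (intBase F) (algebraMap (LTCoeff F) (unitBall (E m))) κ
    (constantCoeff_comp_intBase (E m)) u hu γ (eq_zero_of_C_pi_mul_eq_zero_integer hπ) hreg' w hγ ε v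
  have hκg : κ g = 1 := by rw [hκ, RingHom.comp_apply, hg, map_one]
  have hC1 : PowerSeries.C (1 : unitBall (E m)) = 1 := map_one _
  have hκn : PowerSeries.map κ (PowerSeries.C ((n : ℕ) : PowerSeries 𝒪[F])) = PowerSeries.C (n : unitBall (E m)) := by
    rw [PowerSeries.map_C, map_natCast]
  have key : colemanDeltaCoinvFun hπ hq (algebraMap (LTCoeff F) (unitBall (E m))) u hu γ hreg' w hγ (PowerSeries.map κ ε)
        (TActModule.ofPS _ _ (PowerSeries.map κ (TActModule.toPS x)) :
          ColemanCoordModule hπ hq (algebraMap (LTCoeff F) (unitBall (E m))) u hu γ) =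
      (colemanDeltaCoinvFun hπ hq (algebraMap (LTCoeff F) (unitBall (E m))) u hu γ hreg' w hγ (PowerSeries.map κ ε)
          (unitTwistₗ hπ hq (algebraMap (LTCoeff F) (unitBall (E m))) u hu γ v (TActModule.ofPS _ _ 1)) -
        PowerSeries.C (n : unitBall (E m))) * PowerSeries.map κ L := by
    rw [hbc, hL, map_mul, map_sub, map_mul, PowerSeries.map_C, hκg, hC1, mul_one, hκn, htw]
  rw [hεk] at key
  -- the one-level weight reading
  have hval := tEval_mul_coordMoment_one_eq_of_eq_mul hπ (E m) hq u hu γ hreg' w hγ k v (PowerSeries.C (n : unitBall (E m)))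
    (PowerSeries.map κ L) _ key
  rw [TActModule.toPS_ofPS, tEval_C] at hval
  -- the specialised trace
  have hH : PowerSeries.map κ (TActModule.toPS x) =
      PowerSeries.map (algebraMap 𝒪[F] (unitBall (E m))) (PowerSeries.map (PowerSeries.constantCoeff (R := 𝒪[F]))
        (∑ j : ZMod d, TActModule.toPS (colemanImage hd hπ E hmono hE hdeg hσ₀ hq u hu γ hθ hcoh hβ j))) := by
    rw [hκ, PowerSeries.map_comp, RingHom.comp_apply, hx, indexTraceₗ_apply, map_sum]
  have hspec := sum_unitBallEquiv_mul_coordMoment_specialization hd hπ E hmono hE hdeg hσ₀ hq u hu γ hθ hcoh hβ m k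
  rw [← hH, ← hval] at hspec
  exact hspec.symm

end Summit.BirchSwinnertonDyer.BirchSwinnertonDyer.Theorems.PrintCf2.SeamColemanDictionaryLevel

end
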